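import Summits.QuantumFields.GaugeBoot.BesselCapCheck
import Summits.QuantumFields.GaugeBoot.WordRectangle
import HarnessLib

/-!
# Gauge-boot: the cap witness of the `R × T` rectangle word — both long sides (`R ≥ 2`), every `T`

Cell `ym-instrument` (HOME `run/shared/lean/pub/ym-instrument/`), crew (a), seat `ym-instrument-boot-lean-1`;
A-plan-11 «BESSEL CAP» typing, file 9 (symbolic rectangles, the input of the class-LIMIT support cap
`supp μ_R ⊂ [0, ρ²]`, boot-plan AMEND A-plan-10 COROLLARY / A-plan-11 v2 §1 (B2)).

HONEST FRAMING (page 1 of every file of this cell): pure combinatorics of the rectangle word on `ℤ^d`; nothing is certified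
about any lattice gauge theory at any `(G, D, L, β)`; nothing summit-bearing.

## Content

For `i ≠ j`, `R ≥ 2` and any `T`, the rectangle word `Word.rectangle i j R T` (`(+eᵢ)^R (+eⱼ)^T (−eᵢ)^R (−eⱼ)^T`, tree
`WordRectangle`) read from `0 ∈ ℤ^d` traverses each of the `2T` links of its two sides in direction `j` (the columns
`{R eᵢ + s eⱼ}` and `{s eⱼ}`, `s < T`) exactly once, no two of them share a plaquette (consecutive collinear links never do;
the two columns are at distance `R ≥ 2`), and all read links lie in the box `[0, R] × [0, T]`; hence
`capCheck (rectangle i j R T) (columnLinks i j R T) L₀ = true` for every `L₀ ≥ max(R, T) + 3`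
(`capCheck_rectangle`). With `BesselCapCheck.capCheck_sound` and the cap this gives `|⟨W̄(R×T)⟩| ≤ ρ^{2T}` on every torus
`L ≥ max(R,T) + 3` (file `YangMills/Theorems/Instrument/BesselCapRows`, appended).

Two general facts about `ShareZ` (file `WordEdgesZ`) are proved on the way: links sharing a `ℤ^d` plaquette are within
sup-distance `1` (`ShareZ.abs_sub_le_one`), and two links IN THE SAME DIRECTION `μ` sharing a plaquette have the same
`μ`-coordinate (`ShareZ.apply_eq_of_snd_eq`) — consecutive collinear links never share a plaquette.
-/

namespace Summit.QuantumFields.GaugeBoot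

open Literature.MathematicalPhysics.QuantumFieldTheory

variable {d : ℕ}

/-! ## Two facts about `ShareZ` -/

/-- The links of the plaquette boundary based at `Y` in the plane `{a, b}` have base points in `Y + {0, e_a, e_b}`:
each coordinate exceeds that of `Y` by `0` or `1`. [folklore] -/
theorem sub_mem_zero_one_of_mem_plaquette {Y : Fin d → ℤ} {a b : Fin d} {E : EdgeZ d}
    (h : E ∈ Word.edgesReadZ Y (Word.plaquette a b)) (k : Fin d) : 0 ≤ E.1 k - Y k ∧ E.1 k - Y k ≤ 1 := by
  have hs : ∀ μ : Fin d, 0 ≤ (Pi.single μ (1 : ℤ) : Fin d → ℤ) k ∧ (Pi.single μ (1 : ℤ) : Fin d → ℤ) k ≤ 1 := fun μ => by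
    by_cases hk : k = μ
    · subst hk; simp
    · simp [hk]
  rw [Word.edgesReadZ_plaquette] at h
  simp only [List.mem_cons, List.not_mem_nil, or_false] at h
  rcases h with rfl | rfl | rfl | rfl
  · simp
  · simpa using hs a
  · simpa using hs b
  · simp

/-- A link of the plaquette boundary based at `Y` in the plane `{a, b}`, `a ≠ b`, has the SAME coordinate as `Y` along its
own direction. [folklore] -/
theorem apply_snd_eq_of_mem_plaquette {Y : Fin d → ℤ} {a b : Fin d} (hab : a ≠ b) {E : EdgeZ d}
    (h : E ∈ Word.edgesReadZ Y (Word.plaquette a b)) : E.1 E.2 = Y E.2 := by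
  rw [Word.edgesReadZ_plaquette] at h
  simp only [List.mem_cons, List.not_mem_nil, or_false] at h
  rcases h with rfl | rfl | rfl | rfl
  · rfl
  · simp [hab]
  · simp [Ne.symm hab]
  · rfl

/-- **Links sharing a plaquette are within sup-distance `1`.** [folklore] -/
theorem ShareZ.abs_sub_le_one {E E' : EdgeZ d} (h : ShareZ E E') (k : Fin d) : |E.1 k - E'.1 k| ≤ 1 := by
  obtain ⟨a, b, -, δ, -, hE, hE'⟩ := h
  obtain ⟨h1, h2⟩ := sub_mem_zero_one_of_mem_plaquette hE k
  obtain ⟨h3, h4⟩ := sub_mem_zero_one_of_mem_plaquette hE' k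
  rw [abs_le]; constructor <;> linarith

/-- **Two links in the same direction sharing a plaquette have the same coordinate along that direction** (so consecutive
collinear links never share a plaquette). [folklore] -/
theorem ShareZ.apply_eq_of_snd_eq {E E' : EdgeZ d} (h : ShareZ E E') (hdir : E.2 = E'.2) : E.1 E.2 = E'.1 E.2 := by
  obtain ⟨a, b, hab, δ, -, hE, hE'⟩ := h
  rw [apply_snd_eq_of_mem_plaquette hab.ne hE, hdir, apply_snd_eq_of_mem_plaquette hab.ne hE']

/-! ## The `ℤ^d` readings of straight segments -/

namespace Word

/-- Readings of a forward segment `(+e_k)^n` from `v`: the links `(v + r e_k, k)`, `r < n`. [folklore] -/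
theorem edgesReadZ_replicate_fwd (k : Fin d) : ∀ (n : ℕ) (v : Fin d → ℤ),
    edgesReadZ v (List.replicate n (Step.fwd k)) =
      (List.range n).map (fun r : ℕ => (v + (r : ℤ) • (Pi.single k 1 : Fin d → ℤ), k))
  | 0, v => by simp
  | n + 1, v => by
    rw [List.replicate_succ, edgesReadZ_cons, edgesReadZ_replicate_fwd k n, List.range_succ_eq_map, List.map_cons,
      List.map_map]
    simp only [Step.edgeZ_fwd, Step.dispZ_fwd', Nat.cast_zero, zero_smul, add_zero]
    congr 1
    refine List.map_congr_left fun r _ => ?_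
    simp only [Function.comp_apply, Nat.succ_eq_add_one, Nat.cast_add, Nat.cast_one, add_smul, one_smul,
      Prod.mk.injEq, and_true]
    abel

/-- Readings of a backward segment `(−e_k)^n` from `v`: the links `(v − (r+1) e_k, k)`, `r < n`. [folklore] -/
theorem edgesReadZ_replicate_bwd (k : Fin d) : ∀ (n : ℕ) (v : Fin d → ℤ),
    edgesReadZ v (List.replicate n (Step.bwd k)) =
      (List.range n).map (fun r : ℕ => (v - ((r : ℤ) + 1) • (Pi.single k 1 : Fin d → ℤ), k))
  | 0, v => by simp
  | n + 1, v => by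
    rw [List.replicate_succ, edgesReadZ_cons, edgesReadZ_replicate_bwd k n, List.range_succ_eq_map, List.map_cons,
      List.map_map]
    simp only [Step.edgeZ_bwd, Step.dispZ_bwd', Nat.cast_zero, zero_add, one_smul]
    congr 1
    refine List.map_congr_left fun r _ => ?_
    simp only [Function.comp_apply, Nat.succ_eq_add_one, Nat.cast_add, Nat.cast_one, add_smul, one_smul,
      Prod.mk.injEq, and_true, sub_eq_add_neg, neg_add]
    abel

/-- Readings of a concatenation: the second word is read from the integer endpoint of the first. [folklore] -/
theorem edgesReadZ_append : ∀ (v : Fin d → ℤ) (w₁ w₂ : Word d),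
    edgesReadZ v (w₁ ++ w₂) = edgesReadZ v w₁ ++ edgesReadZ (v + (w₁.map Step.dispZ).sum) w₂
  | v, [], w₂ => by simp
  | v, s :: w₁, w₂ => by
    rw [List.cons_append, edgesReadZ_cons, edgesReadZ_cons, edgesReadZ_append (v + s.dispZ) w₁ w₂, List.map_cons,
      List.sum_cons, add_assoc, List.cons_append]

/-- Net integer displacement of `(+e_k)^n`. [folklore] -/
theorem sum_dispZ_replicate_fwd (k : Fin d) (n : ℕ) :
    ((List.replicate n (Step.fwd k) : Word d).map Step.dispZ).sum = (n : ℤ) • (Pi.single k 1 : Fin d → ℤ) := by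
  induction n with
  | zero => simp
  | succ n ih => rw [List.replicate_succ, List.map_cons, List.sum_cons, ih, Step.dispZ_fwd', Nat.cast_succ, add_smul,
      one_smul, add_comm]

/-- Net integer displacement of `(−e_k)^n`. [folklore] -/
theorem sum_dispZ_replicate_bwd (k : Fin d) (n : ℕ) :
    ((List.replicate n (Step.bwd k) : Word d).map Step.dispZ).sum = -((n : ℤ) • (Pi.single k 1 : Fin d → ℤ)) := by
  induction n with
  | zero => simp
  | succ n ih => rw [List.replicate_succ, List.map_cons, List.sum_cons, ih, Step.dispZ_bwd', Nat.cast_succ, add_smul,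
      one_smul, neg_add, add_comm]

end Word

/-! ## The rectangle word: the point `a eᵢ + b eⱼ`, the columns, the readings -/

section Rectangle

variable (i j : Fin d)

/-- The integer point `a eᵢ + b eⱼ` of the `{i, j}` plane. [folklore] -/
def zvec (a b : ℤ) : Fin d → ℤ := a • (Pi.single i 1 : Fin d → ℤ) + b • (Pi.single j 1 : Fin d → ℤ)

variable {i j}

/-- Coordinates of `a eᵢ + b eⱼ` (`i ≠ j`). [folklore] -/
theorem zvec_apply (hij : i ≠ j) (a b : ℤ) (k : Fin d) :
    zvec i j a b k = if k = i then a else if k = j then b else 0 := by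
  unfold zvec
  by_cases hki : k = i
  · subst hki; simp [hij]
  · by_cases hkj : k = j
    · subst hkj; simp [hki]
    · simp [hki, hkj]

/-- `a eᵢ + b eⱼ` determines `(a, b)` (`i ≠ j`). [folklore] -/
theorem zvec_inj (hij : i ≠ j) {a b a' b' : ℤ} (h : zvec i j a b = zvec i j a' b') : a = a' ∧ b = b' := by
  have hi := congrFun h i
  have hj := congrFun h j
  rw [zvec_apply hij, zvec_apply hij] at hi hj
  simp only [if_true] at hi
  simp only [Ne.symm hij, if_false, if_true] at hj
  exact ⟨hi, hj⟩

/-- `zvec a b + r eᵢ = zvec (a + r) b`. [folklore] -/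
theorem zvec_add_smul_i (a b r : ℤ) : zvec i j a b + r • (Pi.single i 1 : Fin d → ℤ) = zvec i j (a + r) b := by
  unfold zvec; rw [add_smul]; abel

/-- `zvec a b + r eⱼ = zvec a (b + r)`. [folklore] -/
theorem zvec_add_smul_j (a b r : ℤ) : zvec i j a b + r • (Pi.single j 1 : Fin d → ℤ) = zvec i j a (b + r) := by
  unfold zvec; rw [add_smul]; abel

/-- `zvec a b − r eᵢ = zvec (a − r) b`. [folklore] -/
theorem zvec_sub_smul_i (a b r : ℤ) : zvec i j a b - r • (Pi.single i 1 : Fin d → ℤ) = zvec i j (a - r) b := by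
  unfold zvec; rw [sub_smul]; abel

/-- `zvec a b − r eⱼ = zvec a (b − r)`. [folklore] -/
theorem zvec_sub_smul_j (a b r : ℤ) : zvec i j a b - r • (Pi.single j 1 : Fin d → ℤ) = zvec i j a (b - r) := by
  unfold zvec; rw [sub_smul]; abel

variable (i j)

/-- The CAP WITNESS of the `R × T` rectangle: the `2T` links of its two sides in direction `j` — the right column
`(R eᵢ + s eⱼ, j)` and the left column `(s eⱼ, j)`, `s < T`. [folklore] -/
def columnLinks (R T : ℕ) : List (EdgeZ d) :=
  (List.range T).map (fun s : ℕ => (zvec i j R s, j)) ++ (List.range T).map (fun s : ℕ => (zvec i j 0 s, j))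

/-- `|columnLinks| = 2T`. [folklore] -/
@[simp] theorem length_columnLinks (R T : ℕ) : (columnLinks i j R T).length = 2 * T := by
  simp [columnLinks, two_mul]

/-- **The readings of the rectangle word from `0`**: bottom `(r eᵢ, i)`, right column `(R eᵢ + s eⱼ, j)`, top
`((R−u−1) eᵢ + T eⱼ, i)`, left column `((T−u−1) eⱼ, j)`. [folklore] -/
theorem edgesReadZ_rectangle (R T : ℕ) : Word.edgesReadZ 0 (Word.rectangle i j R T) =
    (List.range R).map (fun r : ℕ => (zvec i j r 0, i)) ++ (List.range T).map (fun s : ℕ => (zvec i j R s, j)) ++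
      (List.range R).map (fun u : ℕ => (zvec i j (R - (u + 1)) T, i)) ++
        (List.range T).map (fun u : ℕ => (zvec i j 0 (T - (u + 1)), j)) := by
  unfold Word.rectangle Word.line
  rw [Word.edgesReadZ_append, Word.edgesReadZ_append, Word.edgesReadZ_append, Word.edgesReadZ_replicate_fwd,
    Word.edgesReadZ_replicate_fwd, Word.edgesReadZ_replicate_bwd, Word.edgesReadZ_replicate_bwd]
  simp only [List.map_append, List.sum_append, Word.sum_dispZ_replicate_fwd, Word.sum_dispZ_replicate_bwd, zero_add]
  have hD : ∀ r : ℕ, (r : ℤ) • (Pi.single i 1 : Fin d → ℤ) = zvec i j r 0 := fun r => by simp [zvec]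
  have hA : (R : ℤ) • (Pi.single i 1 : Fin d → ℤ) = zvec i j R 0 := by simp [zvec]
  have hB : (R : ℤ) • (Pi.single i 1 : Fin d → ℤ) + (T : ℤ) • (Pi.single j 1 : Fin d → ℤ) = zvec i j R T := rfl
  have hC : (R : ℤ) • (Pi.single i 1 : Fin d → ℤ) + (T : ℤ) • (Pi.single j 1 : Fin d → ℤ) +
      -((R : ℤ) • (Pi.single i 1 : Fin d → ℤ)) = zvec i j 0 T := by
    simp only [zvec, zero_smul, zero_add]; abel
  rw [hC, hB, hA]
  simp only [zvec_add_smul_j, zvec_sub_smul_i, zvec_sub_smul_j, zero_add, hD]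

variable {i j}

/-- A column list with injective second coordinate has no duplicates. [folklore] -/
theorem nodup_map_range_zvec (hij : i ≠ j) (n : ℕ) (a : ℤ) (μ : Fin d) {f : ℕ → ℤ} (hf : Function.Injective f) :
    ((List.range n).map (fun s : ℕ => (zvec i j a (f s), μ))).Nodup := by
  refine List.nodup_range.map fun s s' h => ?_
  simp only [Prod.mk.injEq, and_true] at h
  exact hf (zvec_inj hij h).2

/-- **Each column link is read exactly once by the rectangle word** (`i ≠ j`, `R ≥ 1`): right column. [folklore] -/
theorem count_rectangle_right (hij : i ≠ j) {R T : ℕ} (hR : 1 ≤ R) {s : ℕ} (hs : s < T) :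
    (Word.edgesReadZ 0 (Word.rectangle i j R T)).count (zvec i j R s, j) = 1 := by
  rw [edgesReadZ_rectangle, List.count_append, List.count_append, List.count_append]
  have hR' : (1 : ℤ) ≤ R := by exact_mod_cast hR
  have c1 : ((List.range R).map (fun r : ℕ => (zvec i j r 0, i))).count (zvec i j R s, j) = 0 :=
    List.count_eq_zero.2 fun h => by
      obtain ⟨r, -, hr⟩ := List.mem_map.1 h; exact hij (Prod.ext_iff.1 hr).2
  have c2 : ((List.range T).map (fun s : ℕ => (zvec i j R s, j))).count (zvec i j R s, j) = 1 :=
    List.count_eq_one_of_mem (nodup_map_range_zvec hij T R j Nat.cast_injective)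
      (List.mem_map.2 ⟨s, List.mem_range.2 hs, rfl⟩)
  have c3 : ((List.range R).map (fun u : ℕ => (zvec i j (R - (u + 1)) T, i))).count (zvec i j R s, j) = 0 :=
    List.count_eq_zero.2 fun h => by
      obtain ⟨r, -, hr⟩ := List.mem_map.1 h; exact hij (Prod.ext_iff.1 hr).2
  have c4 : ((List.range T).map (fun u : ℕ => (zvec i j 0 (T - (u + 1)), j))).count (zvec i j R s, j) = 0 :=
    List.count_eq_zero.2 fun h => by
      obtain ⟨u, -, hu⟩ := List.mem_map.1 h
      have := (zvec_inj hij (Prod.ext_iff.1 hu).1).1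
      omega
  rw [c1, c2, c3, c4]

/-- Each column link is read exactly once: left column. [folklore] -/
theorem count_rectangle_left (hij : i ≠ j) {R T : ℕ} (hR : 1 ≤ R) {s : ℕ} (hs : s < T) :
    (Word.edgesReadZ 0 (Word.rectangle i j R T)).count (zvec i j 0 s, j) = 1 := by
  rw [edgesReadZ_rectangle, List.count_append, List.count_append, List.count_append]
  have hR' : (1 : ℤ) ≤ R := by exact_mod_cast hR
  have c1 : ((List.range R).map (fun r : ℕ => (zvec i j r 0, i))).count (zvec i j 0 s, j) = 0 :=
    List.count_eq_zero.2 fun h => by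
      obtain ⟨r, -, hr⟩ := List.mem_map.1 h; exact hij (Prod.ext_iff.1 hr).2
  have c2 : ((List.range T).map (fun s : ℕ => (zvec i j R s, j))).count (zvec i j 0 s, j) = 0 :=
    List.count_eq_zero.2 fun h => by
      obtain ⟨u, -, hu⟩ := List.mem_map.1 h
      have := (zvec_inj hij (Prod.ext_iff.1 hu).1).1
      omega
  have c3 : ((List.range R).map (fun u : ℕ => (zvec i j (R - (u + 1)) T, i))).count (zvec i j 0 s, j) = 0 :=
    List.count_eq_zero.2 fun h => by
      obtain ⟨r, -, hr⟩ := List.mem_map.1 h; exact hij (Prod.ext_iff.1 hr).2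
  have hinj : Function.Injective (fun u : ℕ => (T : ℤ) - ((u : ℤ) + 1)) := fun a b h => by
    simp only at h; omega
  have c4 : ((List.range T).map (fun u : ℕ => (zvec i j 0 (T - (u + 1)), j))).count (zvec i j 0 s, j) = 1 := by
    refine List.count_eq_one_of_mem (nodup_map_range_zvec hij T 0 j hinj) (List.mem_map.2 ⟨T - (s + 1), ?_, ?_⟩)
    · exact List.mem_range.2 (by omega)
    · simp only [Prod.mk.injEq, and_true]
      congr 1
      push_cast [Nat.cast_sub (show s + 1 ≤ T by omega)]
      ring
  rw [c1, c2, c3, c4]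

/-- All links read by the rectangle word lie in the box `[0, R] × [0, T]` of the `{i, j}` plane: their base points are
`zvec a b` with `0 ≤ a ≤ R`, `0 ≤ b ≤ T`. [folklore] -/
theorem exists_zvec_of_mem_rectangle {R T : ℕ} {E : EdgeZ d}
    (h : E ∈ Word.edgesReadZ 0 (Word.rectangle i j R T)) :
    ∃ a b : ℤ, E.1 = zvec i j a b ∧ 0 ≤ a ∧ a ≤ R ∧ 0 ≤ b ∧ b ≤ T := by
  rw [edgesReadZ_rectangle] at h
  simp only [List.mem_append, List.mem_map, List.mem_range] at h
  rcases h with ((⟨r, hr, rfl⟩ | ⟨s, hs, rfl⟩) | ⟨u, hu, rfl⟩) | ⟨u, hu, rfl⟩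
  · exact ⟨r, 0, rfl, by positivity, by exact_mod_cast hr.le, le_rfl, by positivity⟩
  · exact ⟨R, s, rfl, by positivity, le_rfl, by positivity, by exact_mod_cast hs.le⟩
  · refine ⟨R - (u + 1), T, rfl, ?_, ?_, by positivity, le_rfl⟩
    · have : ((u : ℤ) + 1) ≤ R := by exact_mod_cast hu
      linarith
    · have : (0 : ℤ) ≤ u := by positivity
      linarith
  · refine ⟨0, T - (u + 1), rfl, le_rfl, by positivity, ?_, ?_⟩
    · have : ((u : ℤ) + 1) ≤ T := by exact_mod_cast hu
      linarith
    · have : (0 : ℤ) ≤ u := by positivity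
      linarith

/-- The spread condition for the rectangle word: `max(R, T) + 3 ≤ L₀` suffices. [folklore] -/
theorem spreadOK_rectangle (hij : i ≠ j) {R T L₀ : ℕ} (hR : R + 3 ≤ L₀) (hT : T + 3 ≤ L₀) :
    (Word.rectangle i j R T).SpreadOK L₀ := by
  intro E hE E' hE' k
  obtain ⟨a, b, hEab, ha0, haR, hb0, hbT⟩ := exists_zvec_of_mem_rectangle hE
  obtain ⟨a', b', hEab', ha0', haR', hb0', hbT'⟩ := exists_zvec_of_mem_rectangle hE'
  rw [hEab, hEab', zvec_apply hij, zvec_apply hij]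
  split_ifs <;> omega

/-- **No two column links share a plaquette** (`R ≥ 2`): same column ⇒ same `j`-coordinate would be needed; different
columns are at `i`-distance `R ≥ 2 > 1`. [folklore] -/
theorem not_shareZ_columnLinks (hij : i ≠ j) {R T : ℕ} (hR : 2 ≤ R) {E E' : EdgeZ d} (hE : E ∈ columnLinks i j R T)
    (hE' : E' ∈ columnLinks i j R T) (hne : E ≠ E') : ¬ ShareZ E E' := by
  intro hsh
  unfold columnLinks at hE hE'
  simp only [List.mem_append, List.mem_map] at hE hE'
  -- both links have direction `j` and base point `zvec a s` with `a ∈ {R, 0}`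
  obtain ⟨a, s, rfl, ha⟩ : ∃ (a : ℤ) (s : ℕ), E = (zvec i j a s, j) ∧ (a = R ∨ a = 0) := by
    rcases hE with ⟨s, -, rfl⟩ | ⟨s, -, rfl⟩
    · exact ⟨R, s, rfl, Or.inl rfl⟩
    · exact ⟨0, s, rfl, Or.inr rfl⟩
  obtain ⟨a', s', rfl, ha'⟩ : ∃ (a' : ℤ) (s' : ℕ), E' = (zvec i j a' s', j) ∧ (a' = R ∨ a' = 0) := by
    rcases hE' with ⟨s, -, rfl⟩ | ⟨s, -, rfl⟩
    · exact ⟨R, s, rfl, Or.inl rfl⟩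
    · exact ⟨0, s, rfl, Or.inr rfl⟩
  have hj := hsh.apply_eq_of_snd_eq rfl
  have hi := hsh.abs_sub_le_one i
  simp only [zvec_apply hij, Ne.symm hij, if_false, if_true] at hj hi
  have hss : s = s' := by exact_mod_cast hj
  subst hss
  have hR' : (2 : ℤ) ≤ R := by exact_mod_cast hR
  rcases ha with rfl | rfl <;> rcases ha' with rfl | rfl
  · exact hne rfl
  · rw [abs_le] at hi; omega
  · rw [abs_le] at hi; omega
  · exact hne rfl

variable (i j)

/-- **THE CHECKER ACCEPTS THE RECTANGLE WITNESS**: for `i ≠ j`, `R ≥ 2`, any `T`, and `L₀ ≥ max(R, T) + 3`,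
`capCheck (rectangle i j R T) (columnLinks i j R T) L₀ = true`. [folklore] -/
theorem capCheck_rectangle (hij : i ≠ j) {R T L₀ : ℕ} (hR : 2 ≤ R) (hRL : R + 3 ≤ L₀) (hTL : T + 3 ≤ L₀) :
    capCheck (Word.rectangle i j R T) (columnLinks i j R T) L₀ = true := by
  have hnd : (columnLinks i j R T).Nodup := by
    unfold columnLinks
    refine List.nodup_append.2 ⟨nodup_map_range_zvec hij T R j Nat.cast_injective,
      nodup_map_range_zvec hij T 0 j Nat.cast_injective, ?_⟩
    intro E hE E' hE' hEE'
    obtain ⟨s, -, rfl⟩ := List.mem_map.1 hE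
    obtain ⟨s', -, rfl⟩ := List.mem_map.1 hE'
    have := (zvec_inj hij (Prod.ext_iff.1 hEE').1).1
    have hR' : (2 : ℤ) ≤ R := by exact_mod_cast hR
    omega
  have hcnt : ∀ E ∈ columnLinks i j R T, (Word.edgesReadZ 0 (Word.rectangle i j R T)).count E = 1 := by
    intro E hE
    unfold columnLinks at hE
    simp only [List.mem_append, List.mem_map, List.mem_range] at hE
    have hR1 : 1 ≤ R := le_trans (by norm_num) hR
    rcases hE with ⟨s, hs, rfl⟩ | ⟨s, hs, rfl⟩
    · exact count_rectangle_right hij hR1 hs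
    · exact count_rectangle_left hij hR1 hs
  have hsh : ∀ E ∈ columnLinks i j R T, ∀ E' ∈ columnLinks i j R T, E ≠ E' → ¬ ShareZ E E' :=
    fun E hE E' hE' hne => not_shareZ_columnLinks hij hR hE hE' hne
  have hsp := spreadOK_rectangle hij hRL hTL (R := R) (T := T)
  have h2 : 2 ≤ L₀ := by omega
  simp only [capCheck, Bool.and_eq_true, decide_eq_true_eq]
  exact ⟨⟨⟨⟨h2, hnd⟩, hcnt⟩, hsh⟩, hsp⟩

end Rectangle

end Summit.QuantumFields.GaugeBoot
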